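import Literature.MathematicalPhysics.QuantumFieldTheory.Balaban1983to89.Node00.Record8Chart
import Literature.MathematicalPhysics.QuantumFieldTheory.Balaban1983to89.Node00.StepWeightsOfRecord
import Literature.MathematicalPhysics.QuantumFieldTheory.Balaban1983to89.T4DatumAssemblyTowerOfRecordSupp

/-!
# NODE 00 (YM-PLAN Track A) — STAGE 9: the record whose density tower IS THE REPRESENTED TOWER OF RECORD — `ρ_k := eval rep_k`,
# `𝐓ρ_k := eval (Tstep rep_k)` EXPLICIT, Bałaban's `𝐑` the INDUCED density operation, the datum assembled by the TOWER-FORM assembler;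
# the displayed provisos, the record predicate `IsRecordOfRecord₉C`, its faces, and its refinement to `IsRecordOfRecord₅C` AT THE SHADOW

Cell `pub-ymgap`, NODE 00, definer seat ₇b∕₉ (`pub-ymgap-node00-def-T`, Record9 hand).  [I] = [Balaban1987RG1], [III] = [Balaban1988Convergent],
[IV] = [Balaban1989LargeFieldI], [II′] = [Balaban1989LargeFieldII].

WHAT THIS FILE IS.  Stage ₈ (`Record8`, `Record8Chart`) pinned β, χ, dom, E, the actions and the two action-side format predicates; its density tower was
still the Stage-5 recursion `ρ_{k+1} = R_k(T_k ρ_k)` with `T_k` the Radon–Nikodym transport and `R_k` the residual (0.2)-extraction `rep`.  Stage ₉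
REPLACES THE DENSITY TOWER BY THE REPRESENTED TOWER OF RECORD (`Node00/TStepOfRecord`, `Node00/RepTowerOfRecord`, def-R's `Node00/RStepSlotOfRecord`):
`rep₀ :=` the one-term Wilson start, `rep_{k+1} := Rstep (Tstep rep_k)`, `ρ_k := eval rep_k` — so that (2.18) [III] holds for every `ρ_k` BY CONSTRUCTION —
with the T-step weights OF RECORD `wOfRecord A₁ ζ` (`Node00/StepWeightsOfRecord`: the (3.2)·(3.3) characteristic functions, the (3.4)–(3.9) partition of
unity, the residual (3.16)·(3.20)·(3.21) factor `ζ`).  The datum is assembled by the TOWER FORM of the assembler (`T4DatumAssembly.datumOfTower` through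
the by-name adapter `towerOfRecord9GenSupp`, dag-n23-a): its realisation carries the EXPLICIT `𝐓ρ_k` and the INDUCED `𝐑` (`𝐑(𝐓ρ_k) = ρ_{k+1}`, identity elsewhere) —
no `rnDeriv` in any object of record.

* §1 `Stage9Params` ⊇ `Stage8Params`: def-R's tower numerics `τ9`, the residual `p–p′` selection `ppSel` (A7), [I] (1.16)'s `A₁`, the residual
  fluctuation factor `ζ`, the chart constant `cβ`; `Admissible` = Stage 8's ∧ `0 < cβ` ∧ THE CHART CLAUSE OF RECORD (`Record8Chart`, verbatim) ∧ `1 ≤ τ9.M`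
  — numeric ∕ structural windows only, NO clause on a residual object.
* §2 the θ-keyed plugs: `betaOfRecord₉` (= Stage 8's β of record), the generated histories `gOfRecord₉`, `EOfRecord₉`, `wOfRecord₉`, the representations
  `reprOfRecord₉ θ p k = rep_k`, `reprTOfRecord₉ = Tstep rep_k`, the densities `densOfRecord₉ = eval rep_k`, `tdensOfRecord₉ = eval (Tstep rep_k)`.
* §2b THE 𝐑-CARRIERS PINNED FROM THE TOWER (dag-n13-a's along-the-tower pin, TS-9⁺ answer (A)): the laws of record `SLaw₉ θ P j := S218 P j ρ_j`,
  `TLaw₉ θ P k := ScorrLaw P k (𝐓ρ_k)`, the carriers `VOfRecord₉ θ P : PrintedCarriers14R` (target space `ρ = ρ_j ∧ SLaw₉`, corresponding space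
  `ρ' = 𝐓ρ_k ∧ TLaw₉`, density operation := the INDUCED one), the kernel fact `ROpLeaf (VOfRecord₉ θ P) ↔ ∀ k < K, TLaw₉ θ P k → SLaw₉ θ P (k+1)` ([III] p. 244's
  leaf = law transport along the tower), the Stage-9 residual `residualOfStage9 θ` (Stage 8's with `V := VOfRecord₉ θ`) and the Stage-5 VIEW `θ.toStage5`.
* §3 the CORE of record `coreOfRecord₉ θ` (by hand, hypothesis-free): Stage 8's objects at the β of record, the clause `Sect2Form p k := S218 p k ρ_k` READ AT
  THE REPRESENTED DENSITY.
* §4 THE DISPLAYED PROVISOS `Stage9Params.Provisos θ` (a `Prop` structure — HYPOTHESES under which the tower's two Bochner faces are print's statements: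
  integrable level pieces, measurable label weights (O4) and front factors, the two ζ-laws, def-R's (0.3) provisos of the pre-𝐑 tower IN THE SUPPORT FORM
  `RepData.ProvisosSupp` — (R-C2): the plain form's «every denominator fibre integral ≠ 0» is refuted in the model for χ-weighted pieces by dag-n12-a's
  `not_forall_fibreIntegral_indicatorOuter_ne_zero`; print's (0.3) p. 176 [IV] divides only on the support); from them def-T's `TStepProvisos` (via n02-b's
  three theorems on `wOfRecord`) and the adapter's `GenTowerProvisosSupp`.
* §5 the tower `towerOfRecord₉ θ h` and THE DATUM OF RECORD `datumOfRecord₉ θ h := datumOfTower F N (coreOfRecord₉ θ) (towerOfRecord₉ θ h)`, with its faces: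
  `dens = densOfRecord₉` ∕ `real.Trho = tdensOfRecord₉` (EXPLICIT) ∕ `𝐑(𝐓ρ_k) = ρ_{k+1}` ∕ flow = `genFlow β₉` (ONE history feeds `χ_k` and the flow) ∕ the Stage-0
  clause ∕ binder B1 (= node N23) ∕ `χ`, `IndAss`, `Repr`, `Sect2Form` unfolded ∕ (2.18) BY CONSTRUCTION ∕ the Wilson start ∕ (0.4) at the step ∕
  `∫ρ_k = ∫ρ₀` ∕ integrability of every `ρ_k`, `k ≤ K`.
* §6 THE RECORD PREDICATE `IsRecordOfRecord₉C D w := ∃ θ (h : θ.Provisos), θ.Admissible ∧ D = datumOfRecord₉ θ h ∧ w.C = D.C ∧ (0 < w.γ ∧ w.γ ≤ θ.γ) ∧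
  w.L = θ.L ∧ ∀ P, w.up P = upOfRecord₅C (θ.toStage5) P` (upstream block over the Stage-9 VIEW `θ.toStage5` — Stage 8's dictionary with the 𝐑-carriers
  `V := VOfRecord₉ θ` PINNED FROM THE TOWER (§2b); γ-window clause = Stage 8's), pointed form, world existence.
* §7 THE SHADOW and the refinements.  LOCATED (dag-n23-a, kernel fact): `IsRecordOfRecord₉C → IsRecordOfRecord₈C ∕ ₇C ∕ ₅C` does NOT hold AT THE DATUM —
  the Stage-5…8 datum steps by `R ∘ rnTransport`, the Stage-9 datum by the explicit `𝐓ρ_k` and the induced `𝐑`: two different `FiniteEpsData` terms.  What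
  holds: the Stage-5 parameters `shadow₅OfRecord₉ θ h γ'` — Stage 8's residual with `R :=` the operation induced AT THE RADON–NIKODYM IMAGE
  (`Tower.shadowR`) and the format slot FROZEN at the density of record — have machine core `= coreOfRecord₉ θ` (`rfl`), and n23-a's
  `isRecordOfRecord₅C_shadow` makes every ₉C world a ₅C record AT THE SHADOW DATUM, which has the SAME `C`, `dens`, `βfun`, `av` as `D`
  (`exists_isRecordOfRecord₅C_of_isRecordOfRecord₉C`); hence every WORLD-reading ₅C theorem transfers verbatim (`atWorld_of_isRecordOfRecord₉C`; instances:
  guarded (0.20), N01∕N02∕N04, END from the nodes, B1).  The shadow is a proof device, never an object of record.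

## HONEST FRAMING — what this is NOT

* Definitions of record and kernel bookkeeping.  NOTHING of Bałaban's is asserted: the provisos are DISPLAYED HYPOTHESES (an existential clause a record
  must CERTIFY, never assumed); Theorems 1–2 [III], (2.19)–(2.44) [III], (1.1)–(1.2) [IV], the estimates of [I] are NOT asserted; no node count moves.
* VACUITY STATUS (located): the three tower obligations are PROOFS, so the Stage-9 datum exists only UNDER `h : θ.Provisos`; `IsRecordOfRecord₉C` is
  inhabited iff SOME admissible `θ` satisfies `Provisos` — not constructible from junk today (measurability of products of def-R's classical-choice (2.12)
  minimisers; positivity of the (0.3) denominators): an ANALYTIC item ([III] §3 ∕ [IV] §1 at the objects of record), not bookkeeping.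
* The §2 [III] format slot `S218` is still the Stage-5 RESIDUAL predicate, READ AT `ρ_k` of record, and `ScorrLaw` is a RESIDUAL predicate read at `𝐓ρ_k`;
  their pins over the term tower of `reprOfRecord₉` ∕ `reprTOfRecord₉` ((2.23)–(2.44) typed: `TermTowerOfRecord`, `TkOfRecord`, `Sect2Laws`∕`Sect2LawsT` with the
  bounds as conjuncts) are the next file `Node00/Sect2FormOfRecord` (DEDUP №11).  FORMAT FACE (RIDER №38, node00-def g29's sequencing note): over
  `IsRecordOfRecord₉C` ALONE the `Sect2Form p k` face — and with it `SLaw₉`, `TLaw₉`, hence the pinned 𝐑-leaf — is closable by a junk residual (the ∃θ-witness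
  may take `S218 := fun _ _ _ => True`); FORMAT-reading closers are booked over ₉⁺ = ₉C + the `S218`∕`ScorrLaw` pin, or with the face displayed as a hypothesis;
  world-reading closers transfer by `atWorld_of_isRecordOfRecord₉C` and are unaffected.  The inherited Stage-7 field `rep` (residual (0.2)-extraction) is
  UNREAD at Stage 9 (superseded by the represented tower; an `extends` cannot drop it).
* CARRIERS (TS-9⁺, located by dag-n13-a ∕ n12-a ∕ n24-a; answer R9-a): Stage 9 is an INTERMEDIATE stage.  Only the 𝐑-carriers `V` are pinned (from the tower,
  whose objects of record exist here); the groups `X` ([B8]∕[B10]∕B12∕B13), `Y` [B9], `Z` [B11], `W` [IV] of `upOfRecord₅C (θ.toStage5)` stay RESIDUAL free data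
  never read by the datum, the provisos or admissibility ⇒ a universal node statement reading one of those leaves is NOT a closer target over ₉C (refutable by
  the landed swap lemmas `isRecordOfRecord₈C_updXYZ`, `isRecordOfRecord₇C_updW`, `B9∕B10LeafUnpinnedRecord5C` one stage up); their currency over ₉C is the
  per-record SOCKET form until the carrier-pinning successor record (`XOfRecord` from the (2.18) term tower, `Y9OfRecord`, `Z11OfRecord`, `W15OfRecord` — for `W`
  dag-n12-a's hook `WOfRepr` with `kSel`∕`LF`∕`D189`∕`D1100`, module `Record9W` of the n12 lineage on this file's names; N12's slot is read here in PINNED form =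
  the world's own leaf `(w.up P).rBasicStep`).
* β (plan (β)): `β₉ = β₈` = the Hessian-at-1 of `effActionH` read through the RN∕condKernel version of record (dag-n26-a (2)(3)); a version-free β read off the
  TERM TOWER (`TermTowerOfRecord`, [I] (1.16)∕(2.9)) is OWED and would re-point `βfun` in a successor record.  The action side (E, `effAction`, `wilsonBG`, `Ek`,
  `IndAss`, `Repr`) is Stage 8's VERBATIM (R437); def-B's fine-lattice currency (`IndAFineRT`, `ReprAFineRT`, `EkOfRecordRT`, `wilsonBGOfRecordR`) is a
  successor re-point, not read here.
* One finite four-torus programme at fixed `ε` — NOT the continuum limit on ℝ⁴, NOT infinite volume, NOT OS, NOT a mass gap, NOT the Clay problem.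
-/

noncomputable section

open MeasureTheory
open scoped Matrix.Norms.L2Operator

namespace Literature.MathematicalPhysics.QuantumFieldTheory.Balaban1983to89.Node00

open T4Continuum AveragingRT T4FiniteEpsInhabited FlowStep FlowStepRuns DagBinding T4DatumAssembly

/-! ## §1. Stage-9 parameters and admissibility -/

/-- **Stage-9 family parameters**: the Stage-8 parameters and — for the represented tower of record — def-R's tower numerics `τ9 = (M, Nsz, Nmem)` of the
(2.1) [IV] conditions, the RESIDUAL `p–p′` selection `ppSel` of the R-step (0.3) [IV] on sequences of record (A7), the constant `A₁` of [I] (1.16) entering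
`δ_k` of (3.4) [III], the RESIDUAL fluctuation factors `ζ_{k+1}(R, S)` of (3.16)·(3.20)·(3.21) [III], the RESIDUAL «corresponding space» predicate
`ScorrLaw` of the T-images ([III] remark p.262 ∕ Def. 3 p.279 — the space `𝐑` is assumed to carry into the (2.18) format, p.244), and the normalisation
constant `cβ` of the chart of record.  (Inside this declaration `F` is the inherited flow field of `Stage1Params`; the family is `Fam`.) [cite: Balaban1989LargeFieldI, (2.1) p.182 and (0.3) p.176; Balaban1988Convergent, (3.4) p.265, (3.16) p.268, (3.20)–(3.21) p.269; Balaban1987RG1, (1.16) p.262 and (1.20)–(1.21) p.264 (parameter dictionary)] -/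
structure Stage9Params (Fam : T4Family) (N : ℕ) [NeZero N] extends Stage8Params Fam N where
  /-- def-R's tower numerics `(M, Nsz, Nmem)` of (2.1) [IV] -/
  τ9 : TowerNumerics
  /-- RESIDUAL (A7): the `p–p′` selection `Z ↦ Z″` of the R-step (0.3) [IV] on sequences of record -/
  ppSel : PpSelOfRecord Fam ν τ9.M
  /-- the constant `A₁` of [I] (1.16) (enters `δ_k` of (3.4) [III]) -/
  A₁ : ℝ
  /-- RESIDUAL: the fluctuation factors `ζ_{k+1}(R, S)` of (3.16)·(3.20)·(3.21) [III] -/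
  ζ : ZetaOfRecord Fam N ν τ9.M
  /-- RESIDUAL: the «corresponding space» predicate of the T-image `𝐓ρ_k` ([III] remark p.262, Def. 3 p.279), on step-`(k+1)` densities -/
  ScorrLaw : (p : B12.RunParams) → (k : ℕ) → Density (Fam.P p.K) (k + 1) (SU N) → Prop
  /-- the normalisation constant `c` of the chart of record (`Stage8Params.IsChartOfRecord`) -/
  cβ : ℝ

variable (F : T4Family) (N : ℕ) [NeZero N]

/-- **Admissibility at Stage 9** = Stage-8 admissibility ∧ `0 < cβ` ∧ THE CHART CLAUSE OF RECORD at `cβ` (`Record8Chart`'s conjunct, verbatim) ∧ `1 ≤ τ9.M`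
(genuine `M R_j`-cubes).  NO clause constrains a residual object (`ppSel`, `ζ`, `rep`, the carriers): the analytic provisos are DISPLAYED separately
(`Stage9Params.Provisos`). [cite: Balaban1987RG1, (1.20)–(1.21) p.264; Balaban1989LargeFieldI, (2.1) p.182 (hypothesis dictionary)] -/
def Stage9Params.Admissible (θ : Stage9Params F N) : Prop :=
  θ.toStage8Params.Admissible ∧ 0 < θ.cβ ∧ θ.toStage8Params.IsChartOfRecord θ.cβ ∧ 1 ≤ θ.τ9.M

variable {F N} in
/-- Stage-9 admissibility refines Stage-8 admissibility. [cite: Balaban1987RG1, (0.21) p.256 (bookkeeping)] -/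
theorem Stage9Params.Admissible.toStage8 {θ : Stage9Params F N} (h : θ.Admissible) : θ.toStage8Params.Admissible := h.1

variable {F N} in
/-- … carries the chart clause of record with a positive constant. [cite: Balaban1987RG1, (1.20)–(1.21) p.264 (bookkeeping)] -/
theorem Stage9Params.Admissible.chart {θ : Stage9Params F N} (h : θ.Admissible) : 0 < θ.cβ ∧ θ.toStage8Params.IsChartOfRecord θ.cβ :=
  ⟨h.2.1, h.2.2.1⟩

variable {F N} in
/-- … and a positive interval constant. [cite: Balaban1989LargeFieldII, Thm 1 p.355 (bookkeeping)] -/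
theorem Stage9Params.Admissible.gamma_pos {θ : Stage9Params F N} (h : θ.Admissible) : 0 < θ.γ := h.1.1.1.2

/-! ## §2. The θ-keyed plugs into the represented tower of record -/

/-- The β-functions of record at Stage 9 ARE Stage 8's (`betaOfRecord₈` of the Stage-8 view). [cite: Balaban1987RG1, (1.20)–(1.22) p.264 (bookkeeping)] -/
abbrev betaOfRecord₉ (θ : Stage9Params F N) : HBeta :=
  betaOfRecord₈ F N θ.toStage8Params

/-- The GENERATED HISTORY of the run `p`: `g_k := genSeq β₉ g₀ k` ((0.17)–(0.20) forward) — the ONE history fed to `χ_k`, the slots, the weights AND the flow.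
[cite: Balaban1987RG1, (0.17)–(0.20) pp.255–256] -/
abbrev gOfRecord₉ (θ : Stage9Params F N) (p : B12.RunParams) : ℕ → ℝ :=
  genSeq (betaOfRecord₉ F N θ) p.g0

/-- The normalisation `E(p)` of `ρ₀` at Stage 9 = Stage 8's `EOfRecord` along the generated histories. [cite: Balaban1988Convergent, (1.15) p.249 and Thm 1 p.262 (bookkeeping)] -/
abbrev EOfRecord₉ (θ : Stage9Params F N) : B12.RunParams → ℝ :=
  EOfRecord F N θ.ν θ.Efl θ.logz (fun p => genSeq (betaOfRecord₉ F N θ) p.g0)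

/-- The T-step weights OF RECORD at Stage 9: n02-b's `wOfRecord A₁ ζ` ((3.2)–(3.9), (3.16)·(3.20) [III]). [cite: Balaban1988Convergent, (3.2)–(3.9) pp.265–266, (3.16) p.268, (3.20) p.269] -/
abbrev wOfRecord₉ (θ : Stage9Params F N) : StepWeightsOfRecord F N θ.ν θ.τ9.M :=
  wOfRecord F N θ.ν θ.τ9.M θ.A₁ θ.ζ

/-- **`rep_k` of record at `θ`** along the run `p`: the (2.18) representation of `ρ_k` (FILE 2's `repOfRecord9` at the plugs). [cite: Balaban1988Convergent, (2.18) p.257] -/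
def reprOfRecord₉ (θ : Stage9Params F N) (p : B12.RunParams) (k : ℕ) : Step.Repr218 (F.P p.K) (SU N) k :=
  repOfRecord9 F N θ.ν θ.τ9 (EOfRecord₉ F N θ) (wOfRecord₉ F N θ) θ.ppSel p (gOfRecord₉ F N θ p) k

/-- **`Tstep rep_k` of record at `θ`**: the (2.18) representation of `𝐓ρ_k` BEFORE the R-step ((3.25) [III]). [cite: Balaban1988Convergent, (3.25) p.270] -/
def reprTOfRecord₉ (θ : Stage9Params F N) (p : B12.RunParams) (k : ℕ) : Step.Repr218 (F.P p.K) (SU N) (k + 1) :=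
  repTOfRecord9 F N θ.ν θ.τ9 (EOfRecord₉ F N θ) (wOfRecord₉ F N θ) θ.ppSel p (gOfRecord₉ F N θ p) k

/-- **`ρ_k := eval rep_k`** — THE DENSITY OF RECORD at Stage 9, an explicit function of the field. [cite: Balaban1988Convergent, (2.18) p.257 and (0.2) p.244] -/
def densOfRecord₉ (θ : Stage9Params F N) (p : B12.RunParams) (k : ℕ) : Density (F.P p.K) k (SU N) :=
  rhoOfRecord9 F N θ.ν θ.τ9 (EOfRecord₉ F N θ) (wOfRecord₉ F N θ) θ.ppSel p (gOfRecord₉ F N θ p) k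

/-- **`𝐓ρ_k := eval (Tstep rep_k)`** — the T-stepped density of record, EXPLICIT. [cite: Balaban1988Convergent, (3.1) p.264 and (3.25) p.270] -/
def tdensOfRecord₉ (θ : Stage9Params F N) (p : B12.RunParams) (k : ℕ) : Density (F.P p.K) (k + 1) (SU N) :=
  trhoOfRecord9 F N θ.ν θ.τ9 (EOfRecord₉ F N θ) (wOfRecord₉ F N θ) θ.ppSel p (gOfRecord₉ F N θ p) k

/-- (2.18) holds for `ρ_k` with `rep_k` of record, BY CONSTRUCTION. [cite: Balaban1988Convergent, (2.18) p.257 (bookkeeping)] -/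
theorem holds_densOfRecord₉ (θ : Stage9Params F N) (p : B12.RunParams) (k : ℕ) :
    (reprOfRecord₉ F N θ p k).Holds (densOfRecord₉ F N θ p k) :=
  holds_repOfRecord9 F N θ.ν θ.τ9 _ _ θ.ppSel p _ k

/-- (2.18) holds for `𝐓ρ_k` with `Tstep rep_k` of record, BY CONSTRUCTION. [cite: Balaban1988Convergent, (3.25) p.270 (bookkeeping)] -/
theorem holds_tdensOfRecord₉ (θ : Stage9Params F N) (p : B12.RunParams) (k : ℕ) :
    (reprTOfRecord₉ F N θ p k).Holds (tdensOfRecord₉ F N θ p k) :=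
  holds_repTOfRecord9 F N θ.ν θ.τ9 _ _ θ.ppSel p _ k

/-- `ρ₀` of record is the Wilson start `e^{−E(p)}·exp(−A∕g₀²)` at the run's bare coupling. [cite: Balaban1988Convergent, Thm 1 p.262] -/
theorem densOfRecord₉_zero (θ : Stage9Params F N) (p : B12.RunParams) :
    densOfRecord₉ F N θ p 0 = rhoZeroOfRecord F N p.K p.g0 (EOfRecord₉ F N θ p) := by
  rw [densOfRecord₉, rhoOfRecord9_zero]
  exact congrArg (fun x => rhoZeroOfRecord F N p.K x (EOfRecord₉ F N θ p)) (genSeq_zero _ _)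

/-- `ρ_{k+1}` of record IS the slice density of def-R's R-stepped pre-𝐑 slot (`rfl`; FILE 2's `rhoOfRecord9_succ`). [cite: Balaban1989LargeFieldI, (0.3) p.176 (bookkeeping)] -/
theorem densOfRecord₉_succ (θ : Stage9Params F N) (p : B12.RunParams) (k : ℕ) :
    densOfRecord₉ F N θ p (k + 1)
      = densityOfSlice F N θ.ν θ.τ9.M p (gOfRecord₉ F N θ p) (k + 1)
          (rstepSlotOfRecord F N θ.ν θ.τ9 θ.ppSel p (gOfRecord₉ F N θ p) (k + 1)
            (slotsTOfRecord F N θ.ν θ.τ9 (EOfRecord₉ F N θ) (wOfRecord₉ F N θ) θ.ppSel p (gOfRecord₉ F N θ p) (k + 1))) := rfl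

/-! ## §2b. The 𝐑-carriers PINNED FROM THE TOWER; the Stage-5 view of record -/

/-- **`SLaw₉ θ P j`** — the §2 [III] format law of `ρ_j` OF RECORD: the residual predicate `S218` READ AT `densOfRecord₉ θ P j` (the core's `Sect2Form P j`,
verbatim). [cite: Balaban1988Convergent, (2.18) p.257 with (2.23)–(2.44) (the predicate, read at the object of record)] -/
def SLaw₉ (θ : Stage9Params F N) (p : B12.RunParams) (j : ℕ) : Prop :=
  θ.res.S218 p j (densOfRecord₉ F N θ p j)

/-- **`TLaw₉ θ P k`** — the «corresponding space» law of `𝐓ρ_k` OF RECORD: the residual predicate `ScorrLaw` READ AT `tdensOfRecord₉ θ P k`.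
[cite: Balaban1988Convergent, remark p.262 and Def. 3 p.279 (the predicate, read at the object of record)] -/
def TLaw₉ (θ : Stage9Params F N) (p : B12.RunParams) (k : ℕ) : Prop :=
  θ.ScorrLaw p k (tdensOfRecord₉ F N θ p k)

/-- **THE 𝐑-CARRIERS OF THE RUN `P`, PINNED ALONG THE REPRESENTED TOWER OF RECORD** (dag-n13-a's along-the-tower pin): lattice data `F.P P.K`, group `SU(N)`,
`K := P.K`; target space `S j ρ :↔ ρ = ρ_j ∧ SLaw₉ θ P j`; corresponding space `Scorr (k+1) ρ' :↔ ρ' = 𝐓ρ_k ∧ TLaw₉ θ P k`, `Scorr 0 :≡ ⊥`; density operation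
`R k :=` the operation INDUCED by the R-step — `𝐓ρ_k ↦ ρ_{k+1}`, identity elsewhere (`T4DatumAssembly.inducedAt`; = the tower's `inducedR`).  Hypothesis-free.
So bound, [III] p. 244's leaf `ROpLeaf` IS law transport along the tower (`rOpLeaf_VOfRecord₉_iff`) — content exactly that of the residual laws `ScorrLaw` ∕ `S218`
(pinned by the §2-format file `Node00/Sect2FormOfRecord`, not here). [cite: Balaban1988Convergent, p.244 and remark p.262; Balaban1989LargeFieldI, (0.2)–(0.3) p.176] -/
def VOfRecord₉ (θ : Stage9Params F N) (p : B12.RunParams) : PrintedCarriers14R where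
  P := F.P p.K
  G := SU N
  instGG := inferInstance
  instMS := inferInstance
  instHD := inferInstance
  K := p.K
  R := fun k => inducedAt (tdensOfRecord₉ F N θ p k) (densOfRecord₉ F N θ p (k + 1))
  Scorr := fun j ρ' => match j with
    | 0 => False
    | k + 1 => ρ' = tdensOfRecord₉ F N θ p k ∧ TLaw₉ F N θ p k
  S := fun j ρ => ρ = densOfRecord₉ F N θ p j ∧ SLaw₉ F N θ p j

/-- The pinned density operation maps `𝐓ρ_k ↦ ρ_{k+1}` ((0.2)∕(0.3) at the objects of record). [cite: Balaban1989LargeFieldI, (0.2)–(0.3) p.176 (bookkeeping)] -/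
theorem R_VOfRecord₉_tdens (θ : Stage9Params F N) (p : B12.RunParams) (k : ℕ) :
    (VOfRecord₉ F N θ p).R k (tdensOfRecord₉ F N θ p k) = densOfRecord₉ F N θ p (k + 1) :=
  inducedAt_self _ _

/-- **[III] p. 244's LEAF AT THE PINNED CARRIERS IS LAW TRANSPORT ALONG THE TOWER**: `ROpLeaf (VOfRecord₉ θ P) ↔ ∀ k < K, TLaw₉ θ P k → SLaw₉ θ P (k+1)` — «`𝐑𝐓ρ_k`,
`𝐓ρ_k` in the corresponding space, has the form (2.18) with the §2 conditions» read at the objects of record (dag-n13-a module 8 §2's reading; here direct from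
`DagBinding.rOpLeaf_iff`). [cite: Balaban1988Convergent, p.244 and remark p.262; Balaban1989LargeFieldII, Thm 1 p.355 (what the leaf says; bookkeeping)] -/
theorem rOpLeaf_VOfRecord₉_iff (θ : Stage9Params F N) (p : B12.RunParams) :
    ROpLeaf (VOfRecord₉ F N θ p) ↔ ∀ k, k < p.K → TLaw₉ F N θ p k → SLaw₉ F N θ p (k + 1) := by
  rw [rOpLeaf_iff]
  refine ⟨fun h k hk hT => ?_, fun h k hk ρ' hρ' => ?_⟩
  · have hS := h k hk (tdensOfRecord₉ F N θ p k) ⟨rfl, hT⟩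
    rw [R_VOfRecord₉_tdens] at hS
    exact hS.2
  · obtain ⟨rfl, hT⟩ := hρ'
    show (VOfRecord₉ F N θ p).S (k + 1) ((VOfRecord₉ F N θ p).R k (tdensOfRecord₉ F N θ p k))
    rw [R_VOfRecord₉_tdens]
    exact ⟨rfl, h k hk hT⟩

/-- **THE STAGE-9 RESIDUAL**: Stage 8's residual (β, χ, dom, E, R, actions, format predicates at the objects) with the 𝐑-carriers `V := VOfRecord₉ θ` PINNED FROM
THE TOWER.  LOCATED (TS-9⁺, R9-a): the carrier groups `X` ([B8]∕[B10]∕B12∕B13), `Y` [B9], `Z` [B11], `W` [IV] stay RESIDUAL free data at Stage 9 — the datum,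
the provisos and admissibility never read them — so no universal node statement reading those leaves is a closer target over `IsRecordOfRecord₉C`; their
pins from objects of record are the carrier-pinning successor record. [cite: Balaban1988Convergent, p.244; Balaban1989LargeFieldI, (0.2)–(0.6) pp.176–177 (dictionary; bookkeeping)] -/
def residualOfStage9 (θ : Stage9Params F N) : Residual₅ F N :=
  { residualOfStage8 F N θ.toStage8Params with V := VOfRecord₉ F N θ }

/-- **The Stage-5 VIEW of Stage-9 parameters** (what the record's upstream block is bound over): `θ`'s Stage-3 dictionary and `γ`, residual := `residualOfStage9 θ`.
[cite: Balaban1989LargeFieldII, Thm 1 p.355 (bookkeeping)] -/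
def Stage9Params.toStage5 (θ : Stage9Params F N) : Stage5Params F N :=
  { θ.toStage5Params with res := residualOfStage9 F N θ }

/-- The view's 𝐑-carriers ARE the pinned ones (`rfl`). [cite: Balaban1988Convergent, p.244 (bookkeeping)] -/
theorem Stage9Params.toStage5_res_V (θ : Stage9Params F N) (p : B12.RunParams) : (θ.toStage5 F N).res.V p = VOfRecord₉ F N θ p := rfl

/-- **THE RECORD'S 𝐑-LEAF, UNFOLDED**: at the C-binding of record over the Stage-9 view, the run's `rOperation` leaf IS law transport along the tower of record.
[cite: Balaban1988Convergent, p.244; Balaban1989LargeFieldII, Thm 1 p.355 (bookkeeping)] -/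
theorem rOperation_upOfRecord₅C_stage9_iff (θ : Stage9Params F N) (p : B12.RunParams) :
    (upOfRecord₅C F N (θ.toStage5 F N) p).rOperation ↔ ∀ k, k < p.K → TLaw₉ F N θ p k → SLaw₉ F N θ p (k + 1) := by
  show ROpLeaf (VOfRecord₉ F N θ p) ↔ _
  exact rOpLeaf_VOfRecord₉_iff F N θ p

/-! ## §3. The core of record (hypothesis-free) -/

/-- **THE CORE OF RECORD at `θ`** (`RGMachineCore`, by hand): the β of record, `E`, def-R's domains and `χ` along the generated histories, def-B's background
Wilson action ∕ effective action ∕ expansion term and the two action-side format predicates AT THE OBJECTS (Stage 8 verbatim), and the §2 [III] clause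
`Sect2Form p k := S218 p k ρ_k` READ AT THE REPRESENTED DENSITY `densOfRecord₉ θ p k` — never a free truth value. [cite: Balaban1987RG1, (0.17)–(0.24) pp.255–257 and Thm 3 p.264; Balaban1988Convergent, (2.17)–(2.18) p.257; Balaban1989LargeFieldII, Thm 1 p.355 (the clauses, read at the objects)] -/
def coreOfRecord₉ (θ : Stage9Params F N) : RGMachineCore F (SU N) where
  βfun := betaOfRecord₉ F N θ
  E := EOfRecord₉ F N θ
  dom := fun p k => domAltOfRecord F N θ.ν p.K k
  effAction := effActionOfRecord F N (chi7 F N θ.toStage8Params) (betaOfRecord₉ F N θ)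
  wilsonBG := wilsonBGOfRecord F N θ.εbg
  Ek := EkOfRecord F N (chi7 F N θ.toStage8Params) θ.εbg (betaOfRecord₉ F N θ)
  χ := fun p k => chiOfRecord F N θ.ν (gOfRecord₉ F N θ p) p.K k
  Repr := fun p k => ReprAOfRecord F N (chi7 F N θ.toStage8Params) θ.εbg (betaOfRecord₉ F N θ) p k (prefixOf (gOfRecord₉ F N θ p) k)
    (domAltOfRecord F N θ.ν p.K k) (effActionOfRecord F N (chi7 F N θ.toStage8Params) (betaOfRecord₉ F N θ) p k)
    (wilsonBGOfRecord F N θ.εbg p k) (EkOfRecord F N (chi7 F N θ.toStage8Params) θ.εbg (betaOfRecord₉ F N θ) p k)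
  IndAss := fun p k => IndAOfRecord F N (chi7 F N θ.toStage8Params) θ.εbg (betaOfRecord₉ F N θ) p k (prefixOf (gOfRecord₉ F N θ p) k)
    (domAltOfRecord F N θ.ν p.K k) (effActionOfRecord F N (chi7 F N θ.toStage8Params) (betaOfRecord₉ F N θ) p k)
    (wilsonBGOfRecord F N θ.εbg p k) (EkOfRecord F N (chi7 F N θ.toStage8Params) θ.εbg (betaOfRecord₉ F N θ) p k)
  Sect2Form := fun p k => θ.res.S218 p k (densOfRecord₉ F N θ p k)

/-- The core's Wilson start IS `ρ₀` of record (`densOfRecord₉_zero` read at the core; `rfl` up to it). [cite: Balaban1988Convergent, Thm 1 p.262 (bookkeeping)] -/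
theorem rhoZero_coreOfRecord₉ (θ : Stage9Params F N) (p : B12.RunParams) :
    (coreOfRecord₉ F N θ).rhoZero p = densOfRecord₉ F N θ p 0 := by
  rw [densOfRecord₉_zero]
  rfl

/-! ## §4. The displayed provisos of the tower of record -/

/-- **THE DISPLAYED PROVISOS of the represented tower of record at `θ`** — HYPOTHESES under which the tower's two Bochner-integral faces are print's
statements (never admissibility clauses, never fields of an object): `intPiece` — the level-`k` pieces `χ_k(s)·slot_k(s)` of `ρ_k` are integrable
(`k < K`; at `k = 0` a theorem, `intPiece_zero`); `measω` — n02-b's (O4): the (3.2)–(3.9)·(3.16) label weights are jointly measurable in `(V′, U)` (def-R's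
(2.12) minimiser is a classical-choice function); `measChi` — the new front factors `χ_{k+1}(s′)` are measurable (same reason); `zetaUnity` ∕ `zetaAbs` — the
two displayed laws of the residual `ζ` ((3.16) resolves unity, (3.21)); `rstep` — def-R's (0.3) provisos of the pre-𝐑 tower of record at every level
`k+1 ≤ K` (measurable, non-negative, uniformly bounded pieces, nowhere-vanishing denominators), instance-generic in `DecidableEq (PBond …)`. [cite: Balaban1988Convergent, (2.18) p.257, (3.2)–(3.9) pp.265–266, (3.16) p.268, (3.20)–(3.21) p.269; Balaban1989LargeFieldI, (0.3)–(0.4) p.176] -/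
structure Stage9Params.Provisos (θ : Stage9Params F N) : Prop where
  /-- the level-`k` pieces `χ_k(s)·slot_k(s)` of `ρ_k` are integrable, `k < K` -/
  intPiece : ∀ (p : B12.RunParams) (k : ℕ), k < p.K → ∀ s : SeqOfRecord F θ.ν θ.τ9.M (gOfRecord₉ F N θ p) p.K k,
    Integrable (fun U => chiSeqOfRecord F N θ.ν θ.τ9.M (gOfRecord₉ F N θ p) p.K k s U *
      slotsOfRecord F N θ.ν θ.τ9 (EOfRecord₉ F N θ) (wOfRecord₉ F N θ) θ.ppSel p (gOfRecord₉ F N θ p) k s U) (fieldMeasure (F.P p.K) k (SU N))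
  /-- (O4): the label weights `ω = a·b·ζ` are jointly measurable in `(V′, U)`, `k < K` -/
  measω : ∀ (p : B12.RunParams) (k : ℕ), k < p.K → ∀ (s : SeqOfRecord F θ.ν θ.τ9.M (gOfRecord₉ F N θ p) p.K k)
    (t : LbOfRecord F θ.ν p (gOfRecord₉ F N θ p) k),
    Measurable (fun z : GaugeField (F.P p.K) (k + 1) (SU N) × GaugeField (F.P p.K) k (SU N) =>
      ωOfRecord F N θ.ν θ.τ9.M p (gOfRecord₉ F N θ p) k θ.A₁ θ.ζ s t z.2 z.1)
  /-- the new front factors `χ_{k+1}(s′)` are measurable, `k < K` -/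
  measChi : ∀ (p : B12.RunParams) (k : ℕ), k < p.K → ∀ s' : SeqOfRecord F θ.ν θ.τ9.M (gOfRecord₉ F N θ p) p.K (k + 1),
    Measurable (chiSeqOfRecord F N θ.ν θ.τ9.M (gOfRecord₉ F N θ p) p.K (k + 1) s')
  /-- the residual `ζ` resolves unity: `Σ_{(R,S)} ζ_{k+1}(R,S) = 1` -/
  zetaUnity : IsZetaUnity F N θ.ν θ.τ9.M θ.ζ
  /-- the residual `ζ` has `Σ_{(R,S)} |ζ_{k+1}(R,S)| ≤ 1` -/
  zetaAbs : IsZetaAbsLeOne F N θ.ν θ.τ9.M θ.ζ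
  /-- def-R's (0.3) provisos of the pre-𝐑 tower of record, SUPPORT FORM (R-C2), at every level `k+1 ≤ K`, at every instance -/
  rstep : ∀ (p : B12.RunParams) (k : ℕ) [DecidableEq (PBond (F.P p.K) (k + 1))], k < p.K →
    (towerRepOfRecord F N θ.ν θ.τ9 (slotsTOfRecord F N θ.ν θ.τ9 (EOfRecord₉ F N θ) (wOfRecord₉ F N θ) θ.ppSel) θ.ppSel p
      (gOfRecord₉ F N θ p) (k + 1)).toRepData.ProvisosSupp

variable {F N}

/-- **def-T's step provisos FROM the Stage-9 provisos** at every step `k < K`: the weight clauses `measW` ∕ `absW_le` ∕ `unity` are n02-b's three theorems on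
`wOfRecord` modulo the displayed (O4) and ζ-laws. [cite: Balaban1988Convergent, (3.2)–(3.9) pp.265–266, (3.16) p.268, (3.24)–(3.25) p.270] -/
theorem Stage9Params.Provisos.tstep {θ : Stage9Params F N} (h : θ.Provisos) (p : B12.RunParams) (k : ℕ) (hk : k < p.K) :
    TStepProvisos F N θ.ν θ.τ9 (EOfRecord₉ F N θ) (wOfRecord₉ F N θ) θ.ppSel p (gOfRecord₉ F N θ p) k where
  intPiece := h.intPiece p k hk
  measW := fun s' => measurable_wOfRecord F N θ.ν θ.τ9.M θ.A₁ θ.ζ p (gOfRecord₉ F N θ p) k (h.measω p k hk) s'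
  absW_le := fun s' U V' => abs_wOfRecord_le_one F N θ.ν θ.τ9.M θ.A₁ h.zetaAbs p (gOfRecord₉ F N θ p) k s' U V'
  measChi := h.measChi p k hk
  unity := isStepUnity_wOfRecord F N θ.ν θ.τ9.M θ.A₁ h.zetaUnity p (gOfRecord₉ F N θ p) k

/-- **The adapter's support-form provisos along the generated histories FROM the Stage-9 provisos** (both bundles instance-generic in
`DecidableEq (PBond …)`; the core's `E`, `βfun` ARE `EOfRecord₉ θ`, `betaOfRecord₉ θ` — `convert … <;> rfl`). [cite: Balaban1989LargeFieldI, (0.3)–(0.4) p.176 (bookkeeping)] -/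
theorem Stage9Params.Provisos.genTowerProvisosSupp {θ : Stage9Params F N} (h : θ.Provisos) :
    GenTowerProvisosSupp F N θ.ν θ.τ9 (coreOfRecord₉ F N θ) (wOfRecord₉ F N θ) θ.ppSel where
  tstep := fun p k hk => h.tstep p k hk
  rstep := fun p k _ hk => by convert h.rstep p k hk <;> rfl

/-- … and along the histories `gOfRecord₉ θ` (`GenTowerProvisosSupp.towerProvisosSupp`). [cite: Balaban1989LargeFieldI, (0.3)–(0.4) p.176 (bookkeeping)] -/
theorem Stage9Params.Provisos.towerProvisosSupp {θ : Stage9Params F N} (h : θ.Provisos) :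
    TowerProvisosSupp F N θ.ν θ.τ9 (coreOfRecord₉ F N θ) (wOfRecord₉ F N θ) θ.ppSel (gOfRecord₉ F N θ) :=
  h.genTowerProvisosSupp.towerProvisosSupp

variable (F N)

/-! ## §5. The tower and the datum of record; faces -/

/-- **THE TOWER OF RECORD at `θ` under its provisos**: the support-form adapter `towerOfRecord9GenSupp` at the core of record — `ρ p k = densOfRecord₉ θ p k`,
`Trho p k = tdensOfRecord₉ θ p k`, the three obligations def-T's three faces. [cite: Balaban1988Convergent, (0.2) p.244, (2.18) p.257, (3.25) p.270; Balaban1989LargeFieldI, (0.4) p.176] -/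
def towerOfRecord₉ (θ : Stage9Params F N) (h : θ.Provisos) : (coreOfRecord₉ F N θ).Tower (avOfRecord F N) :=
  towerOfRecord9GenSupp h.genTowerProvisosSupp

/-- **THE DATUM OF RECORD, STAGE 9**: the tower-form assembler at the core and the tower of record — construction over `eval rep_k`, realisation with the
EXPLICIT `𝐓ρ_k` and the INDUCED `𝐑`. [cite: Balaban1989LargeFieldII, Thm 1 + (0.1) pp.355–356; Balaban1988Convergent, (0.2) p.244] -/
def datumOfRecord₉ (θ : Stage9Params F N) (h : θ.Provisos) : FiniteEpsData F (SU N) :=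
  datumOfTower F N (coreOfRecord₉ F N θ) (towerOfRecord₉ F N θ h)

/-- The tower's densities ARE `densOfRecord₉` (`rfl`). [cite: Balaban1988Convergent, (2.18) p.257 (bookkeeping)] -/
theorem towerOfRecord₉_ρ (θ : Stage9Params F N) (h : θ.Provisos) (p : B12.RunParams) (k : ℕ) :
    (towerOfRecord₉ F N θ h).ρ p k = densOfRecord₉ F N θ p k := rfl

/-- The tower's `𝐓ρ_k` ARE `tdensOfRecord₉` (`rfl`). [cite: Balaban1988Convergent, (3.25) p.270 (bookkeeping)] -/
theorem towerOfRecord₉_Trho (θ : Stage9Params F N) (h : θ.Provisos) (p : B12.RunParams) (k : ℕ) :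
    (towerOfRecord₉ F N θ h).Trho p k = tdensOfRecord₉ F N θ p k := rfl

/-- **THE TOWER OF RECORD IS INTEGRABLE** (every `ρ_k`, `k ≤ K`) — from the displayed provisos (adapter's `isIntegrable_towerOfRecord9GenSupp`). [cite: Balaban1988Convergent, (0.2) p.244 (bookkeeping)] -/
theorem isIntegrable_towerOfRecord₉ (θ : Stage9Params F N) (h : θ.Provisos) : (towerOfRecord₉ F N θ h).IsIntegrable :=
  isIntegrable_towerOfRecord9GenSupp h.genTowerProvisosSupp

/-- FACE `dens`: the datum's densities ARE `densOfRecord₉` at the run `(K, F.m, g₀)` (`rfl`). [cite: Balaban1988Convergent, (2.18) p.257 (bookkeeping)] -/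
theorem dens_datumOfRecord₉ (θ : Stage9Params F N) (h : θ.Provisos) (K : ℕ) (g₀ : ℝ) (k : ℕ) :
    (datumOfRecord₉ F N θ h).dens K g₀ k = densOfRecord₉ F N θ ⟨K, F.m, g₀⟩ k := rfl

/-- FACE `Trho` (EXPLICIT): the datum's realised `𝐓ρ_k` ARE `tdensOfRecord₉` (`rfl`) — no `rnDeriv`. [cite: Balaban1988Convergent, (3.25) p.270 (bookkeeping)] -/
theorem trho_datumOfRecord₉ (θ : Stage9Params F N) (h : θ.Provisos) (K : ℕ) (g₀ : ℝ) (k : ℕ) :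
    (datumOfRecord₉ F N θ h).real.Trho K g₀ k = tdensOfRecord₉ F N θ ⟨K, F.m, g₀⟩ k := rfl

/-- FACE `𝐑` (INDUCED): the datum's large-field operation IS the tower's induced operation (`rfl`) … [cite: Balaban1989LargeFieldI, (0.2)–(0.3) p.176 (bookkeeping)] -/
theorem R_datumOfRecord₉ (θ : Stage9Params F N) (h : θ.Provisos) (K : ℕ) (g₀ : ℝ) (k : ℕ) :
    (datumOfRecord₉ F N θ h).real.R K g₀ k = (towerOfRecord₉ F N θ h).inducedR ⟨K, F.m, g₀⟩ k := rfl

/-- … IS the pinned carriers' density operation at the run `(K, F.m, g₀)` (`rfl`) … [cite: Balaban1989LargeFieldI, (0.2)–(0.3) p.176 (bookkeeping)] -/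
theorem R_datumOfRecord₉_eq_VOfRecord₉ (θ : Stage9Params F N) (h : θ.Provisos) (K : ℕ) (g₀ : ℝ) (k : ℕ) :
    (datumOfRecord₉ F N θ h).real.R K g₀ k = (VOfRecord₉ F N θ ⟨K, F.m, g₀⟩).R k := rfl

/-- … and maps `𝐓ρ_k ↦ ρ_{k+1}` ((0.2) `ρ_{k+1} = 𝐑𝐓ρ_k` at the objects of record). [cite: Balaban1988Convergent, (0.2) p.244; Balaban1989LargeFieldI, (0.3) p.176] -/
theorem R_tdens_datumOfRecord₉ (θ : Stage9Params F N) (h : θ.Provisos) (K : ℕ) (g₀ : ℝ) (k : ℕ) :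
    (datumOfRecord₉ F N θ h).real.R K g₀ k (tdensOfRecord₉ F N θ ⟨K, F.m, g₀⟩ k) = densOfRecord₉ F N θ ⟨K, F.m, g₀⟩ (k + 1) :=
  (towerOfRecord₉ F N θ h).inducedR_Trho ⟨K, F.m, g₀⟩ k

/-- FACE construction: the datum's `C` is the core's construction over the densities of record (`rfl`) — the term a binding world sets as its `C`.
[cite: Balaban1989LargeFieldII, Thm 1 + (0.1) pp.355–356 (bookkeeping)] -/
theorem datumOfRecord₉_C (θ : Stage9Params F N) (h : θ.Provisos) :
    (datumOfRecord₉ F N θ h).C = (coreOfRecord₉ F N θ).construction (densOfRecord₉ F N θ) := rfl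

/-- FACE β: the datum's β-functions ARE the β of record (`rfl`). [cite: Balaban1987RG1, (1.20)–(1.22) p.264 (bookkeeping)] -/
theorem βfun_datumOfRecord₉ (θ : Stage9Params F N) (h : θ.Provisos) : (datumOfRecord₉ F N θ h).βfun = betaOfRecord₉ F N θ := rfl

/-- FACE flow: every run's flow is generated FORWARD by (0.20) with the β of record (`rfl`). [cite: Balaban1987RG1, (0.17)–(0.20) pp.255–256 (bookkeeping)] -/
theorem flow_datumOfRecord₉ (θ : Stage9Params F N) (h : θ.Provisos) (p : B12.RunParams) :
    ((datumOfRecord₉ F N θ h).C p).flow = genFlow (betaOfRecord₉ F N θ) p.g0 := rfl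

/-- **ONE HISTORY**: the couplings carried by the run's flow ARE `gOfRecord₉ θ p` — the history `χ_k`, the slots and the step weights are indexed by (`rfl`).
[cite: Balaban1987RG1, (0.17)–(0.20) pp.255–256; Balaban1988Convergent, (2.17)–(2.18) p.257] -/
theorem flow_g_datumOfRecord₉ (θ : Stage9Params F N) (h : θ.Provisos) (p : B12.RunParams) :
    ((datumOfRecord₉ F N θ h).C p).flow.g = gOfRecord₉ F N θ p := rfl

/-- FACE av: the averaging maps are the averaging operations of record (`rfl`). [cite: Balaban1987RG1, (0.4) p.253 (bookkeeping)] -/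
theorem av_datumOfRecord₉ (θ : Stage9Params F N) (h : θ.Provisos) : (datumOfRecord₉ F N θ h).av = avOfRecord F N := rfl

/-- STAGE-0 DATUM CLAUSE at the Stage-9 datum (`rfl`). [cite: Balaban1987RG1, (0.3)–(0.4) p.253] -/
theorem isDatumOfRecord₀_datumOfRecord₉ (θ : Stage9Params F N) (h : θ.Provisos) : IsDatumOfRecord₀ F N (datumOfRecord₉ F N θ h) := rfl

/-- **BINDER B1 = NODE N23 AT THE STAGE-9 DATUM**, hypothesis-free beyond the provisos that build it. [cite: Balaban1987RG1, (0.4) p.253] -/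
theorem isPrintedAveraged_datumOfRecord₉ (θ : Stage9Params F N) (h : θ.Provisos) : (datumOfRecord₉ F N θ h).IsPrintedAveraged :=
  isPrintedAveraged_datumOfTower F N _ _

/-- FACE χ: the construction's `χ_k` IS def-R's `chiOfRecord` along the generated history (`rfl`). [cite: Balaban1988Convergent, (2.17) p.257 (bookkeeping)] -/
theorem chi_stage9 (θ : Stage9Params F N) (h : θ.Provisos) (p : B12.RunParams) (k : ℕ) :
    ((datumOfRecord₉ F N θ h).C p).χ k = chiOfRecord F N θ.ν (gOfRecord₉ F N θ p) p.K k := rfl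

/-- FACE actions: background Wilson action, effective action and expansion term ARE def-B's of record at the β of record (`rfl`s). [cite: Balaban1987RG1, (0.17)–(0.23) pp.255–256 (bookkeeping)] -/
theorem actions_stage9 (θ : Stage9Params F N) (h : θ.Provisos) (p : B12.RunParams) (k : ℕ) :
    ((datumOfRecord₉ F N θ h).C p).wilsonBG k = wilsonBGOfRecord F N θ.εbg p k ∧
      ((datumOfRecord₉ F N θ h).C p).effAction k = effActionOfRecord F N (chi7 F N θ.toStage8Params) (betaOfRecord₉ F N θ) p k ∧
        ((datumOfRecord₉ F N θ h).C p).Ek k = EkOfRecord F N (chi7 F N θ.toStage8Params) θ.εbg (betaOfRecord₉ F N θ) p k :=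
  ⟨rfl, rfl, rfl⟩

/-- FACE `IndAss` (the plug line dag-n09-a (o1) reads): the clause IS def-B's `IndAOfRecord` read at the generated history and the record's objects — Stage 8's
reading VERBATIM (`Iff.rfl`). [cite: Balaban1987RG1, (1.1)–(1.6) pp.260–261 and Thm 3 p.264 (bookkeeping)] -/
theorem indAss_stage9_iff (θ : Stage9Params F N) (h : θ.Provisos) (p : B12.RunParams) (k : ℕ) :
    ((datumOfRecord₉ F N θ h).C p).IndAss k ↔
      IndAOfRecord F N (chi7 F N θ.toStage8Params) θ.εbg (betaOfRecord₉ F N θ) p k (prefixOf (gOfRecord₉ F N θ p) k)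
        (domAltOfRecord F N θ.ν p.K k) (effActionOfRecord F N (chi7 F N θ.toStage8Params) (betaOfRecord₉ F N θ) p k)
        (wilsonBGOfRecord F N θ.εbg p k) (EkOfRecord F N (chi7 F N θ.toStage8Params) θ.εbg (betaOfRecord₉ F N θ) p k) := Iff.rfl

/-- FACE `Repr`: the clause IS def-B's `ReprAOfRecord` read at the same arguments (`Iff.rfl`). [cite: Balaban1987RG1, (0.22)–(0.24) p.256 and Thm 1 p.257 (bookkeeping)] -/
theorem repr_stage9_iff (θ : Stage9Params F N) (h : θ.Provisos) (p : B12.RunParams) (k : ℕ) :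
    ((datumOfRecord₉ F N θ h).C p).Repr k ↔
      ReprAOfRecord F N (chi7 F N θ.toStage8Params) θ.εbg (betaOfRecord₉ F N θ) p k (prefixOf (gOfRecord₉ F N θ p) k)
        (domAltOfRecord F N θ.ν p.K k) (effActionOfRecord F N (chi7 F N θ.toStage8Params) (betaOfRecord₉ F N θ) p k)
        (wilsonBGOfRecord F N θ.εbg p k) (EkOfRecord F N (chi7 F N θ.toStage8Params) θ.εbg (betaOfRecord₉ F N θ) p k) := Iff.rfl

/-- FACE `Sect2Form`: the §2 [III] clause IS the residual format predicate READ AT THE REPRESENTED DENSITY `ρ_k = eval rep_k` (`Iff.rfl`). [cite: Balaban1989LargeFieldII, Thm 1 p.355; Balaban1988Convergent, (2.18) p.257 (bookkeeping)] -/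
theorem sect2Form_stage9_iff (θ : Stage9Params F N) (h : θ.Provisos) (p : B12.RunParams) (k : ℕ) :
    ((datumOfRecord₉ F N θ h).C p).Sect2Form k ↔ θ.res.S218 p k (densOfRecord₉ F N θ p k) := Iff.rfl

/-- **(2.18) HOLDS FOR THE DATUM'S DENSITIES WITH `rep_k` OF RECORD, BY CONSTRUCTION.** [cite: Balaban1988Convergent, (2.18) p.257] -/
theorem holds_dens_datumOfRecord₉ (θ : Stage9Params F N) (h : θ.Provisos) (K : ℕ) (g₀ : ℝ) (k : ℕ) :
    (reprOfRecord₉ F N θ ⟨K, F.m, g₀⟩ k).Holds ((datumOfRecord₉ F N θ h).dens K g₀ k) :=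
  holds_densOfRecord₉ F N θ _ k

/-- (2.18) for the realised `𝐓ρ_k` with `Tstep rep_k` of record, by construction. [cite: Balaban1988Convergent, (3.25) p.270 (bookkeeping)] -/
theorem holds_trho_datumOfRecord₉ (θ : Stage9Params F N) (h : θ.Provisos) (K : ℕ) (g₀ : ℝ) (k : ℕ) :
    (reprTOfRecord₉ F N θ ⟨K, F.m, g₀⟩ k).Holds ((datumOfRecord₉ F N θ h).real.Trho K g₀ k) :=
  holds_tdensOfRecord₉ F N θ _ k

/-- FACE Wilson start: `ρ₀ = e^{−E}·exp(−A∕g₀²)`. [cite: Balaban1988Convergent, Thm 1 p.262] -/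
theorem dens_zero_datumOfRecord₉ (θ : Stage9Params F N) (h : θ.Provisos) (K : ℕ) (g₀ : ℝ) :
    (datumOfRecord₉ F N θ h).dens K g₀ 0 = rhoZeroOfRecord F N K g₀ (EOfRecord₉ F N θ ⟨K, F.m, g₀⟩) :=
  densOfRecord₉_zero F N θ ⟨K, F.m, g₀⟩

/-- FACE push-forward: `𝐓ρ_k` IS an averaging-of-record image of `ρ_k` (`k < K`; def-T's `isRT_trhoOfRecord9` under the provisos). [cite: Balaban1988Convergent, (3.1) p.264, (3.24)–(3.25) p.270] -/
theorem isRT_trho_datumOfRecord₉ (θ : Stage9Params F N) (h : θ.Provisos) (K : ℕ) (g₀ : ℝ) (k : ℕ) (hk : k < K) :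
    IsRT (avOfRecord F N K k).avg ((datumOfRecord₉ F N θ h).dens K g₀ k) ((datumOfRecord₉ F N θ h).real.Trho K g₀ k) :=
  (towerOfRecord₉ F N θ h).isRT_Trho ⟨K, F.m, g₀⟩ k hk

/-- FACE (0.4) at the step: `∫ρ_{k+1} = ∫𝐓ρ_k` (`k < K`; def-R's (0.3) provisos IN THE SUPPORT FORM via FILE 9′ and FILE 2). [cite: Balaban1989LargeFieldI, (0.4) p.176] -/
theorem integral_dens_succ_datumOfRecord₉ (θ : Stage9Params F N) (h : θ.Provisos) (K : ℕ) (g₀ : ℝ) (k : ℕ) (hk : k < K) :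
    ∫ V, (datumOfRecord₉ F N θ h).dens K g₀ (k + 1) V ∂fieldMeasure (F.P K) (k + 1) (SU N)
      = ∫ V, (datumOfRecord₉ F N θ h).real.Trho K g₀ k V ∂fieldMeasure (F.P K) (k + 1) (SU N) :=
  (towerOfRecord₉ F N θ h).integral_succ ⟨K, F.m, g₀⟩ k hk

/-- `∫ρ_k = ∫ρ₀ (= Z^ε)` along every run, `k ≤ K` (`Tower.integral_eq_integral_zero`). [cite: Balaban1985UV3, (6) p.257] -/
theorem integral_dens_eq_zero_datumOfRecord₉ (θ : Stage9Params F N) (h : θ.Provisos) (K : ℕ) (g₀ : ℝ) (k : ℕ) (hk : k ≤ K) :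
    ∫ V, (datumOfRecord₉ F N θ h).dens K g₀ k V ∂fieldMeasure (F.P K) k (SU N)
      = ∫ U, (datumOfRecord₉ F N θ h).dens K g₀ 0 U ∂fieldMeasure (F.P K) 0 (SU N) :=
  (towerOfRecord₉ F N θ h).integral_eq_integral_zero ⟨K, F.m, g₀⟩ k hk

/-- FACE integrability: every density of the datum, `k ≤ K`, is integrable (from the provisos). [cite: Balaban1988Convergent, (0.2) p.244 (bookkeeping)] -/
theorem integrable_dens_datumOfRecord₉ (θ : Stage9Params F N) (h : θ.Provisos) (K : ℕ) (g₀ : ℝ) (k : ℕ) (hk : k ≤ K) :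
    Integrable ((datumOfRecord₉ F N θ h).dens K g₀ k) (fieldMeasure (F.P K) k (SU N)) :=
  isIntegrable_towerOfRecord₉ F N θ h ⟨K, F.m, g₀⟩ k hk

/-- … and so is every realised `𝐓ρ_k`, `k < K`. [cite: Balaban1988Convergent, (3.25) p.270 (bookkeeping)] -/
theorem integrable_trho_datumOfRecord₉ (θ : Stage9Params F N) (h : θ.Provisos) (K : ℕ) (g₀ : ℝ) (k : ℕ) (hk : k < K) :
    Integrable ((datumOfRecord₉ F N θ h).real.Trho K g₀ k) (fieldMeasure (F.P K) (k + 1) (SU N)) :=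
  integrable_towerOfRecord9Supp_Trho h.towerProvisosSupp ⟨K, F.m, g₀⟩ k hk

/-- The T⁴ apex at the Stage-9 datum, B1 eliminated (`continuumYM4Torus_datumOfTower`). [cite: JaffeWittenClay2006, §6.5 p.11] -/
theorem continuumYM4Torus_datumOfRecord₉ (θ : Stage9Params F N) (h : θ.Provisos)
    (hB : B16.EndStatementBPrinted (datumOfRecord₉ F N θ h).C)
    (hE : EndpointExistence (datumOfRecord₉ F N θ h).C.toB12)
    (hNE : T4ApexHybrid.HybridNE7Under (datumOfRecord₉ F N θ h) (EndpointExistence (datumOfRecord₉ F N θ h).C.toB12)) :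
    T4ContinuumYM4Torus.ContinuumYM4Torus (datumOfRecord₉ F N θ h) :=
  continuumYM4Torus_datumOfTower F N _ _ hB hE hNE

/-! ## §6. The Stage-9 record predicate (C-binding) -/

/-- **«(D, w) is the record, Stage 9»** (C-binding): admissible Stage-9 parameters SATISFYING THEIR DISPLAYED PROVISOS whose datum of record IS `D`, and a world
bound to its construction with a window `0 < w.γ ≤ θ.γ` (Stage 8's clause: `θ.γ` is the radius of the history box on which the β of record is the merged β),
Bałaban's block size and the C-binding of record over the Stage-8 carriers.  The provisos are an EXISTENTIAL CLAUSE a record certifies — never assumed.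
[cite: Balaban1989LargeFieldII, Thm 1 + (0.1) pp.355–356; Balaban1988Convergent, (0.2) p.244, (2.18) p.257; Balaban1989LargeFieldI, (0.2)–(0.4) p.176; Balaban1987RG1, (0.17)–(0.24) pp.255–257 and (1.20)–(1.22) p.264 (objects of record, Stage 9 dictionary)] -/
def IsRecordOfRecord₉C (D : FiniteEpsData F (SU N)) (w : WorldP) : Prop :=
  ∃ (θ : Stage9Params F N) (h : θ.Provisos), θ.Admissible ∧ D = datumOfRecord₉ F N θ h ∧ w.C = D.C ∧ (0 < w.γ ∧ w.γ ≤ θ.γ) ∧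
    w.L = (θ.L : ℝ) ∧ ∀ P : B12.RunParams, w.up P = upOfRecord₅C F N (θ.toStage5 F N) P

/-- **Pointed form**: admissible Stage-9 parameters with their provisos, and a world bound to the construction of their datum, a window, `θ.L` and the upstream
block of record, form a Stage-9 record. [cite: Balaban1989LargeFieldII, Thm 1 + (0.1) pp.355–356 (bookkeeping)] -/
theorem isRecordOfRecord₉C_of_eq (θ : Stage9Params F N) (h : θ.Provisos) (hθ : θ.Admissible) (w : WorldP)
    (hC : w.C = (datumOfRecord₉ F N θ h).C) (hγ : 0 < w.γ ∧ w.γ ≤ θ.γ) (hL : w.L = (θ.L : ℝ))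
    (hup : ∀ P, w.up P = upOfRecord₅C F N (θ.toStage5 F N) P) :
    IsRecordOfRecord₉C F N (datumOfRecord₉ F N θ h) w :=
  ⟨θ, h, hθ, rfl, hC, hγ, hL, hup⟩

/-- **Every admissible Stage-9 parameter satisfying its provisos IS a Stage-9 record at some world**, with any window `0 < γw ≤ θ.γ` — so inhabitation of the
record class is EXACTLY «some admissible θ satisfies the displayed provisos». [cite: Balaban1989LargeFieldII, Thm 1 + (0.1) pp.355–356 (bookkeeping)] -/
theorem exists_world_isRecordOfRecord₉C (θ : Stage9Params F N) (h : θ.Provisos) (hθ : θ.Admissible) {γw : ℝ} (hγw : 0 < γw ∧ γw ≤ θ.γ) :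
    ∃ w : WorldP, IsRecordOfRecord₉C F N (datumOfRecord₉ F N θ h) w ∧ w.γ = γw := by
  obtain ⟨w₀⟩ := nonempty_worldP
  exact ⟨{ w₀ with
      C := (datumOfRecord₉ F N θ h).C, γ := γw, L := (θ.L : ℝ), one_lt_L := by exact_mod_cast θ.hL.2,
      up := fun P => upOfRecord₅C F N (θ.toStage5 F N) P },
    ⟨θ, h, hθ, rfl, rfl, hγw, rfl, fun _ => rfl⟩, rfl⟩

section Consequences

variable {F N}
variable {D : FiniteEpsData F (SU N)} {w : WorldP}

/-- A Stage-9 record CERTIFIES its parameters' provisos and admissibility. [cite: Balaban1989LargeFieldI, (0.3)–(0.4) p.176 (bookkeeping)] -/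
theorem exists_provisos_of_isRecordOfRecord₉C (h : IsRecordOfRecord₉C F N D w) :
    ∃ (θ : Stage9Params F N) (hP : θ.Provisos), θ.Admissible ∧ D = datumOfRecord₉ F N θ hP := by
  obtain ⟨θ, hP, hθ, hD, -⟩ := h
  exact ⟨θ, hP, hθ, hD⟩

/-- Binding clause 1: the world's construction IS the datum's. [cite: Balaban1989LargeFieldII, Thm 1 p.355 (bookkeeping)] -/
theorem construction_eq_of_isRecordOfRecord₉C (h : IsRecordOfRecord₉C F N D w) : w.C = D.C := by
  obtain ⟨θ, hP, -, -, hC, -⟩ := h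
  exact hC

/-- Binding clause 2: the interval constant is positive (and at most the witness's box radius). [cite: Balaban1989LargeFieldII, Thm 1 p.355 (bookkeeping)] -/
theorem gamma_pos_of_isRecordOfRecord₉C (h : IsRecordOfRecord₉C F N D w) : 0 < w.γ := by
  obtain ⟨θ, hP, -, -, -, hγ, -⟩ := h
  exact hγ.1

/-- A Stage-9 record's datum is a datum of record, Stage 0. [cite: Balaban1987RG1, (0.3)–(0.4) p.253 (bookkeeping)] -/
theorem isDatumOfRecord₀_of_isRecordOfRecord₉C (h : IsRecordOfRecord₉C F N D w) : IsDatumOfRecord₀ F N D := by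
  obtain ⟨θ, hP, -, rfl, -⟩ := h
  exact isDatumOfRecord₀_datumOfRecord₉ F N θ hP

/-- N23 · binder B1 at every Stage-9 record. [cite: Balaban1987RG1, (0.4) p.253] -/
theorem isPrintedAveraged_of_isRecordOfRecord₉C (h : IsRecordOfRecord₉C F N D w) : D.IsPrintedAveraged :=
  isPrintedAveraged_of_isDatumOfRecord₀ F N D (isDatumOfRecord₀_of_isRecordOfRecord₉C h)

/-- (2.18) holds for every density of a Stage-9 record's datum, with `rep_k` OF RECORD at the witnessing parameters. [cite: Balaban1988Convergent, (2.18) p.257] -/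
theorem holds_dens_of_isRecordOfRecord₉C (h : IsRecordOfRecord₉C F N D w) :
    ∃ (θ : Stage9Params F N) (hP : θ.Provisos), θ.Admissible ∧ D = datumOfRecord₉ F N θ hP ∧
      ∀ K g₀ k, (reprOfRecord₉ F N θ ⟨K, F.m, g₀⟩ k).Holds (D.dens K g₀ k) := by
  obtain ⟨θ, hP, hθ, rfl, -⟩ := h
  exact ⟨θ, hP, hθ, rfl, fun K g₀ k => holds_dens_datumOfRecord₉ F N θ hP K g₀ k⟩

/-- **A Stage-9 record's 𝐑-leaf IS law transport along its tower of record**, at every run (the junction hypothesis `hR9` of N11∕N13 at ₉, unfolded).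
[cite: Balaban1988Convergent, p.244; Balaban1989LargeFieldII, Thm 1 p.355 (bookkeeping)] -/
theorem exists_rOperation_iff_of_isRecordOfRecord₉C (h : IsRecordOfRecord₉C F N D w) :
    ∃ (θ : Stage9Params F N) (hP : θ.Provisos), θ.Admissible ∧ D = datumOfRecord₉ F N θ hP ∧
      ∀ P : B12.RunParams, (leavesP w P).rOperation ↔ ∀ k, k < P.K → TLaw₉ F N θ P k → SLaw₉ F N θ P (k + 1) := by
  obtain ⟨θ, hP, hθ, hD, -, -, -, hup⟩ := h
  refine ⟨θ, hP, hθ, hD, fun P => ?_⟩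
  show (w.up P).rOperation ↔ _
  rw [hup P]
  exact rOperation_upOfRecord₅C_stage9_iff F N θ P

end Consequences

/-! ## §7. The shadow; refinement to the Stage-5 record predicate AT THE SHADOW; transfer of world-reading theorems -/

/-- **THE SHADOW RESIDUAL of `θ` under its provisos**: the Stage-9 residual with `R :=` the density operation induced AT THE RADON–NIKODYM IMAGE of the tower of
record (`Tower.shadowR`: `rnTransport ρ_k ↦ ρ_{k+1}`, identity elsewhere; its (0.4) and integrability preservation are dag-n23-a's
`preservesIntegral_shadowR_towerOfRecord9Supp` ∕ `integrable_shadowR_towerOfRecord9Supp` at the provisos) and the format slot FROZEN at the density of record (`S218 p k _ := θ.res.S218 p k (densOfRecord₉ θ p k)`, read only there).  A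
PROOF DEVICE for the refinement below — never an object of record. [cite: Balaban1989LargeFieldI, (0.2)–(0.4) p.176; Balaban1987RG1, (0.13) p.254 (bookkeeping)] -/
def shadowResidual₉ (θ : Stage9Params F N) (h : θ.Provisos) : Residual₅ F N :=
  { residualOfStage9 F N θ with
    R := fun p k => (towerOfRecord₉ F N θ h).shadowR p k
    preservesIntegral_R := fun p k hk => preservesIntegral_shadowR_towerOfRecord9Supp h.towerProvisosSupp p k hk
    integrable_R := fun p k hk => integrable_shadowR_towerOfRecord9Supp h.towerProvisosSupp p k hk
    S218 := fun p k _ => θ.res.S218 p k (densOfRecord₉ F N θ p k) }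

/-- **THE SHADOW Stage-5 parameters of `θ`** at interval letter `γ'`: `θ`'s Stage-3 dictionary, `γ := γ'`, residual := the shadow residual.
[cite: Balaban1989LargeFieldI, (0.2) p.176 (bookkeeping)] -/
def shadow₅OfRecord₉ (θ : Stage9Params F N) (h : θ.Provisos) (γ' : ℝ) : Stage5Params F N :=
  { θ.toStage5Params with γ := γ', res := shadowResidual₉ F N θ h }

/-- THE KEY `rfl`: the machine of the shadow has core `coreOfRecord₉ θ` — so the tower of record IS a tower over it. [cite: Balaban1988Convergent, (0.2) p.244 (bookkeeping)] -/
theorem toCore_machineOfRecord₅_shadow₅ (θ : Stage9Params F N) (h : θ.Provisos) (γ' : ℝ) :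
    (machineOfRecord₅ F N (shadow₅OfRecord₉ F N θ h γ')).toCore = coreOfRecord₉ F N θ := rfl

/-- The shadow's residual `R` IS the tower's shadow operation (`rfl`). [cite: Balaban1989LargeFieldI, (0.3) p.176 (bookkeeping)] -/
theorem res_R_shadow₅ (θ : Stage9Params F N) (h : θ.Provisos) (γ' : ℝ) (p : B12.RunParams) (k : ℕ) :
    (shadow₅OfRecord₉ F N θ h γ').res.R p k = (towerOfRecord₉ F N θ h).shadowR p k := rfl

/-- The shadow is Stage-5 admissible iff `θ`'s Stage-1 dictionary is admissible and `0 < γ'`. [cite: Balaban1989LargeFieldII, Thm 1 p.355 (bookkeeping)] -/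
theorem admissible_shadow₅ (θ : Stage9Params F N) (h : θ.Provisos) {γ' : ℝ} (hθ : θ.Admissible) (hγ' : 0 < γ') :
    (shadow₅OfRecord₉ F N θ h γ').Admissible :=
  ⟨hθ.1.1.1.1, hγ'⟩

/-- The shadow's upstream block IS the Stage-9 view's (`rfl`: it reads the Stage-3 dictionary and the carriers only). [cite: Balaban1985UV3, Thm 1 p.257 (bookkeeping)] -/
theorem upOfRecord₅C_shadow₅ (θ : Stage9Params F N) (h : θ.Provisos) (γ' : ℝ) (P : B12.RunParams) :
    upOfRecord₅C F N (shadow₅OfRecord₉ F N θ h γ') P = upOfRecord₅C F N (θ.toStage5 F N) P := rfl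

/-- The shadow datum has the SAME CONSTRUCTION as the Stage-9 datum (n23-a's `datumOfRecord_C_eq_datumOfTower`). [cite: Balaban1989LargeFieldII, Thm 1 + (0.1) pp.355–356 (bookkeeping)] -/
theorem datumOfRecord₅_shadow₅_C (θ : Stage9Params F N) (h : θ.Provisos) (γ' : ℝ) :
    (datumOfRecord₅ F N (shadow₅OfRecord₉ F N θ h γ')).C = (datumOfRecord₉ F N θ h).C :=
  datumOfRecord_C_eq_datumOfTower F N (machineOfRecord₅ F N (shadow₅OfRecord₉ F N θ h γ')) (towerOfRecord₉ F N θ h) (fun _ _ => rfl)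

/-- … the same densities. [cite: Balaban1988Convergent, (0.2) p.244 (bookkeeping)] -/
theorem dens_datumOfRecord₅_shadow₅ (θ : Stage9Params F N) (h : θ.Provisos) (γ' : ℝ) (K : ℕ) (g₀ : ℝ) (k : ℕ) :
    (datumOfRecord₅ F N (shadow₅OfRecord₉ F N θ h γ')).dens K g₀ k = (datumOfRecord₉ F N θ h).dens K g₀ k :=
  dens_datumOfRecord_eq_datumOfTower F N (machineOfRecord₅ F N (shadow₅OfRecord₉ F N θ h γ')) (towerOfRecord₉ F N θ h) (fun _ _ => rfl) K g₀ k

/-- … NODE 00's Stage-5 density tower at the shadow IS the density of record. [cite: Balaban1988Convergent, (0.2) p.244 (bookkeeping)] -/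
theorem densOfRecord₅_shadow₅ (θ : Stage9Params F N) (h : θ.Provisos) (γ' : ℝ) (p : B12.RunParams) (k : ℕ) :
    densOfRecord₅ F N (shadow₅OfRecord₉ F N θ h γ') p k = densOfRecord₉ F N θ p k :=
  densOfRecord₅_eq_tower F N (shadow₅OfRecord₉ F N θ h γ') (towerOfRecord₉ F N θ h) (fun _ _ => rfl) p k

/-- … the same β-functions (`rfl`). [cite: Balaban1987RG1, (1.22) p.264 (bookkeeping)] -/
theorem βfun_datumOfRecord₅_shadow₅ (θ : Stage9Params F N) (h : θ.Provisos) (γ' : ℝ) :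
    (datumOfRecord₅ F N (shadow₅OfRecord₉ F N θ h γ')).βfun = (datumOfRecord₉ F N θ h).βfun := rfl

/-- … and the same averaging maps (`rfl`). [cite: Balaban1987RG1, (0.4) p.253 (bookkeeping)] -/
theorem av_datumOfRecord₅_shadow₅ (θ : Stage9Params F N) (h : θ.Provisos) (γ' : ℝ) :
    (datumOfRecord₅ F N (shadow₅OfRecord₉ F N θ h γ')).av = (datumOfRecord₉ F N θ h).av := rfl

/-- **A STAGE-9 WORLD IS A STAGE-5 RECORD AT THE SHADOW DATUM** (n23-a's `isRecordOfRecord₅C_shadow`, witness: the shadow at the world's own letter `w.γ`).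
[cite: Balaban1989LargeFieldII, Thm 1 + (0.1) pp.355–356; Balaban1988Convergent, (0.2) p.244 (objects of record, bookkeeping)] -/
theorem isRecordOfRecord₅C_shadow₅ (θ : Stage9Params F N) (h : θ.Provisos) (hθ : θ.Admissible) (w : WorldP)
    (hC : w.C = (datumOfRecord₉ F N θ h).C) (hγ : 0 < w.γ) (hL : w.L = (θ.L : ℝ))
    (hup : ∀ P, w.up P = upOfRecord₅C F N (θ.toStage5 F N) P) :
    IsRecordOfRecord₅C F N (datumOfRecord₅ F N (shadow₅OfRecord₉ F N θ h w.γ)) w :=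
  isRecordOfRecord₅C_shadow F N (shadow₅OfRecord₉ F N θ h w.γ) (admissible_shadow₅ F N θ h hθ hγ) (towerOfRecord₉ F N θ h)
    (fun _ _ => rfl) w hC rfl hL hup

variable {F N}

/-- **REFINEMENT `IsRecordOfRecord₉C → IsRecordOfRecord₅C` AT THE SHADOW**: every Stage-9 record's world is a Stage-5 record at a datum with THE SAME
construction, densities, β-functions and averaging maps.  (NOT at `D` itself — located: the Stage-5 datum's realised `Tρ_k` is the Radon–Nikodym transport.)
[cite: Balaban1989LargeFieldII, Thm 1 + (0.1) pp.355–356; Balaban1988Convergent, (0.2) p.244 (bookkeeping)] -/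
theorem exists_isRecordOfRecord₅C_of_isRecordOfRecord₉C {D : FiniteEpsData F (SU N)} {w : WorldP} (h : IsRecordOfRecord₉C F N D w) :
    ∃ D₅ : FiniteEpsData F (SU N), IsRecordOfRecord₅C F N D₅ w ∧ D₅.C = D.C ∧ (∀ K g₀ k, D₅.dens K g₀ k = D.dens K g₀ k) ∧
      D₅.βfun = D.βfun ∧ D₅.av = D.av := by
  obtain ⟨θ, hP, hθ, rfl, hC, ⟨hγ0, -⟩, hL, hup⟩ := h
  exact ⟨_, isRecordOfRecord₅C_shadow₅ F N θ hP hθ w hC hγ0 hL hup, datumOfRecord₅_shadow₅_C F N θ hP w.γ,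
    dens_datumOfRecord₅_shadow₅ F N θ hP w.γ, rfl, rfl⟩

/-- **TRANSFER**: every node statement established over the Stage-5 record predicate in the `AtRecord` shape (`h₅`) holds at every run of every Stage-9 record's
world. [cite: Balaban1989LargeFieldII, Thm 1 p.355 (bookkeeping)] -/
theorem atWorld_of_isRecordOfRecord₉C {X : Dag.Leaves → Prop}
    (h₅ : ∀ (D : FiniteEpsData F (SU N)) (w : WorldP), IsRecordOfRecord₅C F N D w → ∀ P : B12.RunParams, X (leavesP w P))
    {D : FiniteEpsData F (SU N)} {w : WorldP} (h : IsRecordOfRecord₉C F N D w) (P : B12.RunParams) : X (leavesP w P) := by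
  obtain ⟨D₅, h5, -⟩ := exists_isRecordOfRecord₅C_of_isRecordOfRecord₉C h
  exact h₅ D₅ w h5 P

section Transferred

variable {D : FiniteEpsData F (SU N)} {w : WorldP}

/-- Instance · GUARDED (0.20) at every Stage-9 record (the Stage-5 theorem, transferred). [cite: Balaban1987RG1, (0.20) p.256] -/
theorem rgFlow_of_smallCouplings_of_isRecordOfRecord₉C (h : IsRecordOfRecord₉C F N D w) (P : B12.RunParams)
    (hsc : (leavesP w P).smallCouplings) : (leavesP w P).rgFlow := by
  obtain ⟨D₅, h5, -⟩ := exists_isRecordOfRecord₅C_of_isRecordOfRecord₉C h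
  exact rgFlow_of_smallCouplings_of_isRecordOfRecord₅C h5 P hsc

/-- Instance · N01 `Dag.B4_main` at every run of every Stage-9 record. [cite: Balaban1983RegularityDecay, Theorem p.573 (kernel version, transferred)] -/
theorem b4_main_of_isRecordOfRecord₉C (h : IsRecordOfRecord₉C F N D w) (P : B12.RunParams) : Dag.B4_main (leavesP w P) :=
  atWorld_of_isRecordOfRecord₉C (fun _ _ h5 P => b4_main_of_isRecordOfRecord₅C h5 P) h P

/-- Instance · N02 `Dag.B5_main` at every run of every Stage-9 record. [cite: Balaban1984PropagatorsI, Props. 1.1–1.2 pp.33–36 (kernel versions, transferred)] -/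
theorem b5_main_of_isRecordOfRecord₉C (h : IsRecordOfRecord₉C F N D w) (P : B12.RunParams) : Dag.B5_main (leavesP w P) :=
  atWorld_of_isRecordOfRecord₉C (fun _ _ h5 P => b5_main_of_isRecordOfRecord₅C h5 P) h P

/-- Instance · N04 `Dag.B7_main` at every run of every Stage-9 record. [cite: Balaban1985Averaging, Props. 1–10 pp.26–50 (kernel version, transferred)] -/
theorem b7_main_of_isRecordOfRecord₉C (h : IsRecordOfRecord₉C F N D w) (P : B12.RunParams) : Dag.B7_main (leavesP w P) :=
  atWorld_of_isRecordOfRecord₉C (fun _ _ h5 P => b7_main_of_isRecordOfRecord₅C h5 P) h P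

/-- Instance · **the END headline at a Stage-9 record needs NO `rgFlow` binder**: nodes at every run + the β-window binder ⇒ `B16.EndStatementBPrinted D.C`
(the Stage-5 theorem at the shadow, then `D₅.C = D.C`). [cite: Balaban1989LargeFieldII, Thm 1 p.355 + p.391] -/
theorem endStatementBPrinted_of_isRecordOfRecord₉C_of_nodes (h : IsRecordOfRecord₉C F N D w) {γ₀ : ℝ} (hγ₀ : w.γ ≤ γ₀)
    (hnodes : ∀ P, Nodes (leavesP w P)) (hβ : BetaBoundsInInterval w.C.toB12 γ₀ w.b w.βup) :
    B16.EndStatementBPrinted D.C := by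
  obtain ⟨D₅, h5, hC5, -⟩ := exists_isRecordOfRecord₅C_of_isRecordOfRecord₉C h
  rw [← hC5]
  exact endStatementBPrinted_of_isRecordOfRecord₅C_of_nodes h5 hγ₀ hnodes hβ

end Transferred

end Literature.MathematicalPhysics.QuantumFieldTheory.Balaban1983to89.Node00

end
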